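import Summits.Ventures.HodgeRepro.RealApproxSealed
import Summits.Ventures.HodgeRepro.BallCongruenceNF
import Summits.Ventures.HodgeRepro.BallHolo

/-!
# Lemma W at `p = 2` with its finite cover, for every CM field (seat p5)

Blind re-derivation cell `pub-hodge-repro`, seat `p5`.  Built on typer-2's `RealApproxSealed.lean`
(the sealed statement (c) on the arithmetic subgroup `arithSubgroup φ₀ = toU21 (embU φ₀ (UK K 2))`, with
real approximation PROVED) and on p5's `BallInvariance.lean` / `BallCongruenceNF.lean`.  Mathlib otherwise.

ROUTE.md Appendix A4 (Lemma W), read at `p = 2`, `i = 1`, says: for `Γ′`-invariant holomorphic 1-forms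
`η, ω ≢ 0` on the ball some `g ∈ G(ℚ)` has `η ∧ g^*ω ≢ 0`, and `η ∧ g^*ω` is a form on the finite cover
`Γ″\𝔹²`, `Γ″ = Γ′ ∩ g⁻¹Γ′g`.  Every clause of that sentence at the level of cotangent fields on the ball is
now one kernel-checked theorem:

* `isKRational_of_mem_arithSubgroup` — the bridge: every element of typer-2's arithmetic subgroup is
  `K`-rational in the sense of `BallCongruenceNF.IsKRational`;
* **`lemmaW_finiteCover`** — for every CM field `K`, `φ₀ : K ↪ ℂ`, every `Γ′` with
  `Γ(M) ≤ Γ′ ≤ U(2,1)(𝓞_K)` (`M ≠ 0`) and every pair of `Γ′`-invariant continuous fields `F, G ≢ 0` on the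
  sealed ball, some `K`-rational `g` (in `arithSubgroup φ₀`) has: `(g^*F) ∧ G ≢ 0`, `(g^*F) ∧ G` is
  invariant under `Γ′ ⊓ g⁻¹Γ′g`, and `Γ′ ⊓ g⁻¹Γ′g` has finite index in `Γ′`;
* **`lemmaW_finiteCover_holo`** — the holomorphic form: for `ℂ`-analytic `F, G` (p5's `BallHolo`) the
  non-vanishing set of `(g^*F) ∧ G` is moreover OPEN, DENSE and `Γ′ ⊓ g⁻¹Γ′g`-stable — R5's «rank `g`
  generically» at `p = 2` on the finite cover.

Inputs: the sealed (c) (`heckeTranslateWedge_of_lemmaW`, typer-2; p3 / p5 proofs agree), real approximation for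
the split unitary group (`dense_ratPoints`, typer-2 `RealApproxUnitary`), the A4 bookkeeping (p5).  What is NOT
here: the passage from fields on the ball to cohomology classes of the compact quotient (A4's last sentence).
Nothing here says anything about the status of the Hodge conjecture for CM abelian varieties.
-/

set_option autoImplicit false

noncomputable section

namespace Summit.Ventures.HodgeRepro

namespace BallCover

open Matrix hiding J
open NumberField
open BallModel BallInv BallCong BallHolo
open HodgeRepro.BallGen (UK embU ratPoints mem_ratPoints toU21 reM reM_apply Idx)
open HodgeRepro.BallGen.RealApprox (arithSubgroup dense_arithSubgroup heckeTranslateWedge_arith)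

variable {K : Type} [Field K] [NumberField K] [IsCMField K]

omit [NumberField K] [IsCMField K] in
/-- The sealed matrix of a `K`-point `toU21 (embU φ₀ u)` is the `φ₀`-image of a `K`-matrix: the reindexed
matrix of `u`. -/
theorem mapMatrix_submatrix_eq (φ₀ : K →+* ℂ) (u : GL (Idx 2) K) :
    φ₀.mapMatrix ((u : Matrix (Idx 2) (Idx 2) K).submatrix HodgeRepro.BallGen.ι.symm
      HodgeRepro.BallGen.ι.symm) = reM ((u : Matrix (Idx 2) (Idx 2) K).map φ₀) := by
  ext i j
  rfl

/-- **Bridge.**  Every element of typer-2's arithmetic subgroup `arithSubgroup φ₀` is `K`-rational: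
its sealed matrix and inverse matrix have entries in `φ₀(K)`. -/
theorem isKRational_of_mem_arithSubgroup (φ₀ : K →+* ℂ) {g : U21} (hg : g ∈ arithSubgroup φ₀) :
    IsKRational K φ₀ g := by
  obtain ⟨γ, hγ, rfl⟩ := Subgroup.mem_map.1 hg
  obtain ⟨u, rfl⟩ := (mem_ratPoints φ₀ γ).1 hγ
  refine ⟨⟨((u : GL (Idx 2) K) : Matrix (Idx 2) (Idx 2) K).submatrix HodgeRepro.BallGen.ι.symm
      HodgeRepro.BallGen.ι.symm, ?_⟩,
    ⟨(((u⁻¹ : UK K 2) : GL (Idx 2) K) : Matrix (Idx 2) (Idx 2) K).submatrix HodgeRepro.BallGen.ι.symm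
      HodgeRepro.BallGen.ι.symm, ?_⟩⟩
  · rw [mapMatrix_submatrix_eq]
    rfl
  · rw [← map_inv, ← map_inv, mapMatrix_submatrix_eq]
    rfl

/-- **Lemma W at `p = 2` with its finite cover (ROUTE.md A4), for every CM field.**  Let `σ₀ : K ↪ ℂ` be a
CM field, `Γ(M) ≤ Γ′ ≤ U(2,1)(𝓞_K)` with `M ≠ 0`, and `F, G` continuous, `Γ′`-invariant, not identically
zero cotangent fields on the ball (the lifts of two non-zero `Γ′`-invariant holomorphic 1-forms).  Then some
`K`-rational `g ∈ U(2,1)(K)` has: `(g^*F) ∧ G` is not identically zero, it is invariant under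
`Γ″ = Γ′ ⊓ g⁻¹ Γ′ g`, and `Γ″` has finite index in `Γ′`. -/
theorem lemmaW_finiteCover (φ₀ : K →+* ℂ) {Γ' : Subgroup U21} (hΓ : Γ' ≤ arith (φ𝓞 K φ₀)) {M : 𝓞 K}
    (hM0 : M ≠ 0) (hM : congr (φ𝓞 K φ₀) (φ𝓞_injective K φ₀) M ≤ Γ') {F G : Ball → Fin 2 → ℂ}
    (hF : Continuous F) (hG : Continuous G) (hF0 : F ≠ 0) (hG0 : G ≠ 0) (hFΓ : IsInvariant Γ' F)
    (hGΓ : IsInvariant Γ' G) :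
    ∃ g ∈ arithSubgroup φ₀, wedgeForm (pull g F) G ≠ 0 ∧
      IsInvariantTop (Γ' ⊓ conjSub g Γ') (wedgeForm (pull g F) G) ∧
        (Γ' ⊓ conjSub g Γ').IsFiniteRelIndex Γ' := by
  obtain ⟨u, z, hz⟩ := heckeTranslateWedge_arith φ₀ F G hF hG hF0 hG0
  have hmem : toU21 (embU φ₀ u) ∈ arithSubgroup φ₀ :=
    Subgroup.mem_map_of_mem _ ((mem_ratPoints φ₀ _).2 ⟨u, rfl⟩)
  obtain ⟨hinv, hne⟩ := exists_invariantTop_wedgeForm_ne_zero hFΓ hGΓ hz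
  exact ⟨_, hmem, hne, hinv, isFiniteRelIndex_inf_conjSub_numberField K φ₀ hΓ hM0 hM
    (isKRational_of_mem_arithSubgroup φ₀ hmem)⟩


/-- **Holomorphic form of the capstone.**  For `ℂ`-analytic fields `F, G` on the ball, not identically zero,
whose restrictions to the ball are `Γ′`-invariant, some `K`-rational `g` has: the non-vanishing set of
`(g^*F) ∧ G` is OPEN and DENSE in the ball (identity principle) and STABLE under `Γ″ = Γ′ ⊓ g⁻¹ Γ′ g`;
`(g^*F) ∧ G` is `Γ″`-invariant; and `Γ″` has finite index in `Γ′`. -/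
theorem lemmaW_finiteCover_holo (φ₀ : K →+* ℂ) {Γ' : Subgroup U21} (hΓ : Γ' ≤ arith (φ𝓞 K φ₀))
    {M : 𝓞 K} (hM0 : M ≠ 0) (hM : congr (φ𝓞 K φ₀) (φ𝓞_injective K φ₀) M ≤ Γ')
    {F G : (Fin 2 → ℂ) → (Fin 2 → ℂ)} (hF : AnalyticOnNhd ℂ F ballSet) (hG : AnalyticOnNhd ℂ G ballSet)
    (hF0 : ∃ w : Ball, F w.1 ≠ 0) (hG0 : ∃ z : Ball, G z.1 ≠ 0)
    (hFΓ : IsInvariant Γ' fun z : Ball => F z.1) (hGΓ : IsInvariant Γ' fun z : Ball => G z.1) :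
    ∃ g ∈ arithSubgroup φ₀,
      IsOpen {z : Ball | wedgeForm (pull g fun z : Ball => F z.1) (fun z : Ball => G z.1) z ≠ 0} ∧
      Dense {z : Ball | wedgeForm (pull g fun z : Ball => F z.1) (fun z : Ball => G z.1) z ≠ 0} ∧
      (∀ δ ∈ Γ' ⊓ conjSub g Γ', ∀ z : Ball,
        wedgeForm (pull g fun z : Ball => F z.1) (fun z : Ball => G z.1) z ≠ 0 →
          wedgeForm (pull g fun z : Ball => F z.1) (fun z : Ball => G z.1) (act δ z) ≠ 0) ∧
      IsInvariantTop (Γ' ⊓ conjSub g Γ') (wedgeForm (pull g fun z : Ball => F z.1) fun z : Ball => G z.1) ∧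
        (Γ' ⊓ conjSub g Γ').IsFiniteRelIndex Γ' := by
  obtain ⟨g, hg, hopen, hdense⟩ :=
    exists_mem_isOpen_dense_wedge_ne (dense_arithSubgroup φ₀) hF hG hF0 hG0
  have hinv := isInvariantTop_wedgeForm_pull hFΓ hGΓ g
  exact ⟨g, hg, hopen, hdense, fun δ hδ z hz => hinv.ne_zero_act hδ hz, hinv,
    isFiniteRelIndex_inf_conjSub_numberField K φ₀ hΓ hM0 hM (isKRational_of_mem_arithSubgroup φ₀ hg)⟩

end BallCover

end Summit.Ventures.HodgeRepro

end
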